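import Summits.ResolutionOfSingularities.ResolutionOfSingularities.Theorems.WeightedInvariantOrbitCentreHomogeneousKernel
import Summits.ResolutionOfSingularities.ResolutionOfSingularities.Theorems.WeightedInvariantOrbitCentreHomogeneousBaseChange
import Summits.ResolutionOfSingularities.ResolutionOfSingularities.Theorems.WeightedInvariantGermContractionIdealSheaf
import Literature.AlgebraicGeometry.Resolution.StalkIdealLemmas
import HarnessLib

/-!
# (hom) for all chart gradings of the orbit centre — from Abramovich–Quek–Schober's separable base change at
# `k(ℤʲ)` (L3 of the e-ladder rung `e = 1`)

Route `ResolutionOfSingularities/WeightedInvariant`, door crux `HypersurfaceCentreConstruction`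
(stmt-ResolutionOfSingularities-19897) — OURS, helper; e-ladder rung `e = 1`, registered stub `stub_e1_centre` of
`res-L1-w43-stub-10` (cell res-hironaka, `D/res-D-pv-025/DOOR-ELADDER-PLAN.md` §7 item **(L3)** «(hom) for every
grading of every affine `W`: `act*J_n = pr*J_n` on `T′ × W` … equal at its generic point `ζ` by
`IsLexMaxWeightedCentreGerm` UNIQUE ∘ `…_separableBaseChange` (`k′ = k(t)`) ∘ θ-twist»; taken by res-type-047,
OFFER 2026-08-27T07:48Z, plan-1 ACK 07:49Z).  MODULO ⟨F-AQS-T⟩: the Abramovich–Quek–Schober clause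
`AbramovichQuekSchober2025_separableBaseChange` (arXiv:2507.01232, Thm 1.3 (1) / Thm 3.5 "`J` is stable under base
change to separable field extensions of `k`" [cite: AbramovichQuekSchober2025]) is a HYPOTHESIS of both theorems,
exactly as in the rung's registered stubs.

* §7 `isHomogeneous_comap_weightedMonomialIdeal_of_separableBaseChange` — **(L3) at ring level**: `A` a finitely
  generated `k`-algebra graded by `ℤʲ`, `F ⊆ A` a homogeneous ideal (the hypersurface on the chart), `P` a
  homogeneous prime (the orbit closure) with `O = A_P` regular of dimension `2`, `F · O` principal, non-zero, not a
  `(y^ν)`, and `(x; w; ℓ)` the lex-maximal admissible weighted centre germ of `F · O`; then every contracted piece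
  `A ∩ (x^α : w·α ≥ n)` is homogeneous.  Proof = AQS §5 (i) at the GENERIC TORUS POINT instead of `T(k^sep)`-density:
  read the clause on the square of `…OrbitCentreHomogeneousBaseChange` (`Y₀ = Spec A`, `Y′ = Spec (A[ℤʲ]_S)`,
  `k′ = k(ℤʲ)` formally smooth over `k`) at the point `η′ = P · A[ℤʲ]` over `P` (its local ring `B` is a localization
  of `A[ℤʲ]` at `P · A[ℤʲ]`, of dimension `2` by §5 there); it makes `(ε_P ∘ x; w; ℓ)` the lex-maximal centre of
  `F · B`; conclude by the kernel `OrbitCentreHomogeneous.isHomogeneous_comap_weightedMonomialIdeal` (twist `θ_B`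
  + uniqueness + saturation).  No hypothesis on the degree of the constants, no density, `k` finite allowed.
* §8 `isHomogeneous_germContractionIdeal_weightedMonomialIdeal` — **the closer in the e-ladder's vocabulary**: for
  `f : Y → Spec k` locally of finite type, `X` an ideal sheaf, `η` a point with regular 2-dimensional local ring at
  which `X_η` is principal, non-zero, not a `(y^ν)`, `(x; w; ℓ)` lex-maximal for `X_η`, an affine open `W ∋ η` and
  ANY `ℤʲ`-grading `𝒜` of `Γ(Y, W)` with `X(W)` and the prime of `η` homogeneous:
  `(germContractionIdeal η (weightedMonomialIdeal x w n) W).IsHomogeneous 𝒜` for all `n` — the clause `(hom)` of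
  `IsAdmissibleCentre` for the pieces of `ReesAlgebraData.ofGermFiltration η …` (p507610), chart by chart
  (`Γ(Y, W)` is a finitely generated `k`-algebra by `HasRingHomProperty.appLE`, `𝒪_{Y,η}` its localization at the
  prime of `η` by `IsAffineOpen.isLocalization_stalk`, `X_η = X(W) · 𝒪_{Y,η}` by `stalkIdeal_eq_map_germ`).

No definitions.  Nothing here is a claim about Hironaka's problem or about any manuscript under adjudication;
AI-written, weaker than expert review.
-/

noncomputable section

set_option linter.dupNamespace false -- mandated namespace of this single-conjunct summit

namespace Summit.ResolutionOfSingularities.ResolutionOfSingularities.Theorems.OrbitCentreHomogeneous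

open AddMonoidAlgebra DatumToEmbedded.CentreHomogeneous IsLocalRing CategoryTheory AlgebraicGeometry
open Literature.AlgebraicGeometry.Resolution
open scoped AlgebraMonoidAlgebra nonZeroDivisors

/-! ## §7 The lex-maximal centre at the generic torus point (Abramovich–Quek–Schober's separable base change at
`k(ℤʲ)`) and (L3) at ring level -/

section Main

variable {k : Type} [Field k] {j : ℕ} {A : Type} [CommRing A] [Algebra k A]

/-- The coaction sends elements outside a prime `P` outside `P · A[M]` (some homogeneous component of `s ∉ P`
lies outside `P`). [folklore] -/
theorem coaction_not_mem_map_of_not_mem {M σ : Type} [DecidableEq M] [AddCommGroup M] [SetLike σ A]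
    [AddSubgroupClass σ A] (𝒜 : M → σ) [GradedRing 𝒜] (ρ : A →+* A[M])
    (hρ : ∀ (i : M) (a : A), a ∈ 𝒜 i → ρ a = single i a) (P : Ideal A) {s : A} (hs : s ∉ P) :
    ρ s ∉ P.map (singleZeroRingHom : A →+* A[M]) := by
  classical
  intro h
  apply hs
  rw [← DirectSum.sum_support_decompose 𝒜 s]
  refine P.sum_mem fun i _ => ?_
  have := coeff_mem_of_mem_map h i
  rwa [coeff_coaction 𝒜 ρ hρ] at this

/-- **(L3) at ring level, from F-AQS-T.**  Let `A` be a finitely generated algebra over a field `k`, graded by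
`ℤʲ` (`𝒜`), `F ⊆ A` a homogeneous ideal (the hypersurface on the chart) and `P` a homogeneous prime (the orbit
closure) such that the localization `O = A_P` is regular of dimension `2`, `F · O` is principal, non-zero and not
of the form `(y^ν)` for a regular parameter `y`, and `(x; w; ℓ)` is the lex-maximal admissible weighted centre germ
of `F · O` (Abramovich–Quek–Schober).  ASSUMING the separable-base-change clause
`AbramovichQuekSchober2025_separableBaseChange`, every contracted piece `A ∩ (x^α : w·α ≥ n)` is HOMOGENEOUS.
Proof: the base change of `Spec A → Spec k` to `k′ = k(ℤʲ) = Frac k[ℤʲ]` (formally smooth over `k`) is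
`Spec (A[ℤʲ]_S)` (§6); at its point `η′ = P · A[ℤʲ]` (over `P`, local ring `B = A[ℤʲ]_{P·A[ℤʲ]}` of dimension `2`,
§5) the clause makes `(ε_P ∘ x; w; ℓ)` the lex-maximal centre of `F · B`; conclude by the kernel
`OrbitCentreHomogeneous.isHomogeneous_comap_weightedMonomialIdeal` (the twist `θ_B` and saturation).  This is
AQS §5 (i) at the generic torus point; no `T(k)`-density, `k` finite allowed, no degree-`0` hypothesis on the
constants needed. [cite: AbramovichQuekSchober2025, Thm 3.5 and §5 (i)] -/
theorem isHomogeneous_comap_weightedMonomialIdeal_of_separableBaseChange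
    (hAQS₂ : AbramovichQuekSchober2025_separableBaseChange)
    [Algebra.FiniteType k A] {σ : Type} [SetLike σ A] [AddSubgroupClass σ A]
    (𝒜 : (Fin j → ℤ) → σ) [GradedRing 𝒜]
    (F : Ideal A) (hF : F.IsHomogeneous 𝒜) (P : Ideal A) [P.IsPrime] (hP : P.IsHomogeneous 𝒜)
    (O : Type) [CommRing O] [IsLocalRing O] [Algebra A O] [IsLocalization.AtPrime O P]
    (hreg : IsRegularLocalRing O) (hdim : ringKrullDim O = ((2 : ℕ) : WithBot ℕ∞))
    (hprinc : (F.map (algebraMap A O)).IsPrincipal) (hne : F.map (algebraMap A O) ≠ ⊥)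
    (hnot : ∀ y ∈ maximalIdeal O, y ∉ maximalIdeal O ^ 2 →
      ∀ ν : ℕ, F.map (algebraMap A O) ≠ Ideal.span {y ^ ν})
    (x : Fin 2 → O) (w : Fin 2 → ℕ) (ℓ : ℕ)
    (hx : IsLexMaxWeightedCentreGerm O (F.map (algebraMap A O)) x w ℓ) (n : ℕ) :
    ((weightedMonomialIdeal x w n).comap (algebraMap A O)).IsHomogeneous 𝒜 := by
  classical
  obtain ⟨ρ, hρ⟩ := exists_coaction 𝒜
  haveI : IsNoetherianRing A := Algebra.FiniteType.isNoetherianRing k A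
  -- the prime of the generic torus point
  haveI h𝔓 : (P.map (singleZeroRingHom : A →+* A[Fin j → ℤ])).IsPrime := isPrime_map_singleZeroRingHom P
  -- the affine model `Y₀ = Spec A → Spec k` with the ideal sheaf of `F`
  let f₀ : Spec (.of A) ⟶ Spec (.of k) := Spec.map (CommRingCat.ofHom (algebraMap k A))
  haveI : LocallyOfFiniteType f₀ := by
    rw [HasRingHomProperty.Spec_iff (P := @LocallyOfFiniteType)]
    exact RingHom.finiteType_algebraMap.mpr ‹_›
  let X₀ : (Spec (.of A)).IdealSheafData :=
    Scheme.IdealSheafData.ofIdealTop (F.map (Scheme.ΓSpecIso (.of A)).inv.hom)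
  -- the torus-generic base change `Y′ = Spec (A[ℤʲ]_S) → Y₀` over `Spec k(ℤʲ) → Spec k`
  let R' : Type := Localization (Algebra.algebraMapSubmonoid A[Fin j → ℤ] (k[Fin j → ℤ])⁰)
  let g : Spec (.of R') ⟶ Spec (.of A) := Spec.map (CommRingCat.ofHom (algebraMap A R'))
  have hsq : IsPullback g (Spec.map (CommRingCat.ofHom (algebraMap (FractionRing k[Fin j → ℤ]) R'))) f₀
      (Spec.map (CommRingCat.ofHom (algebraMap k (FractionRing k[Fin j → ℤ])))) :=
    isPullback_SpecMap_of_isPushout _ _ _ _ (isPushout_fractionRing_localization k j A)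
  haveI : Algebra.FormallySmooth k (FractionRing k[Fin j → ℤ]) := formallySmooth_fractionRing_addMonoidAlgebra k j
  -- the point `η′ = P · A[ℤʲ]` of `Y′`
  have hdisj := disjoint_algebraMapSubmonoid_map_singleZeroRingHom k j A P Ideal.IsPrime.ne_top'
  haveI h𝔓' : ((P.map (singleZeroRingHom : A →+* A[Fin j → ℤ])).map (algebraMap A[Fin j → ℤ] R')).IsPrime :=
    IsLocalization.isPrime_of_isPrime_disjoint _ R' _ h𝔓 hdisj
  let η' : Spec (.of R') := ⟨(P.map (singleZeroRingHom : A →+* A[Fin j → ℤ])).map (algebraMap A[Fin j → ℤ] R'), h𝔓'⟩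
  have hη'comap : η'.asIdeal.comap (algebraMap A[Fin j → ℤ] R') = P.map singleZeroRingHom :=
    IsLocalization.under_map_of_isPrime_disjoint _ R' h𝔓 hdisj
  have hAR' : algebraMap A R' = (algebraMap A[Fin j → ℤ] R').comp (singleZeroRingHom : A →+* A[Fin j → ℤ]) :=
    IsScalarTower.algebraMap_eq A A[Fin j → ℤ] R'
  have hη₀ : (g.base η').asIdeal = P := by
    change (PrimeSpectrum.comap (algebraMap A R') η').asIdeal = P
    rw [PrimeSpectrum.comap_asIdeal, hAR', ← Ideal.comap_comap, hη'comap, comap_map_singleZeroRingHom]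
  -- the local ring of `Y₀` at `η₀ = g η′` is a localization of `A` at `P`; compare with `O`
  letI algO₀ : Algebra A ((Spec (.of A)).presheaf.stalk (g.base η')) :=
    (StructureSheaf.toStalk A (g.base η')).hom.toAlgebra
  have hloc : IsLocalization.AtPrime ((Spec (.of A)).presheaf.stalk (g.base η')) (g.base η').asIdeal :=
    StructureSheaf.IsLocalization.to_stalk A (g.base η')
  haveI : IsLocalization.AtPrime ((Spec (.of A)).presheaf.stalk (g.base η')) P := by
    have hM : P.primeCompl = (g.base η').asIdeal.primeCompl := by
      ext a; simp only [Ideal.mem_primeCompl_iff, hη₀]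
    change IsLocalization P.primeCompl _
    rw [hM]
    exact hloc
  let e : O ≃+* (Spec (.of A)).presheaf.stalk (g.base η') :=
    (IsLocalization.algEquiv P.primeCompl O ((Spec (.of A)).presheaf.stalk (g.base η'))).toRingEquiv
  have he : (e : O →+* (Spec (.of A)).presheaf.stalk (g.base η')).comp (algebraMap A O) =
      algebraMap A ((Spec (.of A)).presheaf.stalk (g.base η')) :=
    (IsLocalization.algEquiv P.primeCompl O ((Spec (.of A)).presheaf.stalk (g.base η'))).toAlgHom.comp_algebraMap
  have hFe : (F.map (algebraMap A O)).map (e : O →+* (Spec (.of A)).presheaf.stalk (g.base η')) =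
      F.map (algebraMap A ((Spec (.of A)).presheaf.stalk (g.base η'))) := by
    rw [Ideal.map_map, he]
  -- the stalk of `X₀` at `η₀`
  have hX₀ : stalkIdeal X₀ (g.base η') = F.map (algebraMap A ((Spec (.of A)).presheaf.stalk (g.base η'))) := by
    rw [stalkIdeal_eq_map_germ X₀ ⟨⊤, isAffineOpen_top _⟩ trivial]
    simp only [X₀, Scheme.IdealSheafData.ofIdealTop_ideal, Ideal.map_map]
    congr 1
  -- transport of the hypotheses at `η` from `O` to the stalk `O₀` of `Y₀` at `η₀`
  set O₀ := ((Spec (.of A)).presheaf.stalk (g.base η') : Type) with hO₀def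
  have hreg₀ : IsRegularLocalRing O₀ := IsRegularLocalRing.of_ringEquiv e
  have hdim₀ : ringKrullDim O₀ = ((2 : ℕ) : WithBot ℕ∞) := by
    rw [← ringKrullDim_eq_of_ringEquiv e]; exact hdim
  have hprinc₀ : (stalkIdeal X₀ (g.base η')).IsPrincipal := by
    obtain ⟨a, ha⟩ := hprinc
    refine ⟨⟨e a, ?_⟩⟩
    rw [hX₀, ← hFe, ha, Ideal.submodule_span_eq, Ideal.map_span, Set.image_singleton,
      Ideal.submodule_span_eq]
    rfl
  have hne₀ : stalkIdeal X₀ (g.base η') ≠ ⊥ := by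
    rw [hX₀, ← hFe]
    exact fun h => hne ((Ideal.map_eq_bot_iff_of_injective e.injective).mp h)
  have hmax : (maximalIdeal O).map (e : O →+* O₀) = maximalIdeal O₀ :=
    IsLocalRing.map_maximalIdeal_of_surjective (e : O →+* O₀) e.surjective
  have hnot₀ : ∀ y : O₀, y ∈ maximalIdeal O₀ → y ∉ maximalIdeal O₀ ^ 2 →
      ∀ ν : ℕ, stalkIdeal X₀ (g.base η') ≠ Ideal.span {y ^ ν} := by
    intro y hy hy2 ν hEq
    have hy' : e.symm y ∈ maximalIdeal O := by
      rw [← hmax, Ideal.map_comap_of_equiv, Ideal.mem_comap] at hy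
      exact hy
    have hy2' : e.symm y ∉ maximalIdeal O ^ 2 := by
      intro h2
      apply hy2
      have : e (e.symm y) ∈ (maximalIdeal O ^ 2).map (e : O →+* O₀) := Ideal.mem_map_of_mem _ h2
      rw [Ideal.map_pow, hmax, RingEquiv.apply_symm_apply] at this
      exact this
    refine hnot (e.symm y) hy' hy2' ν ?_
    have h3 := congrArg (Ideal.map (e.symm : O₀ →+* O)) hEq
    rw [hX₀, ← hFe, Ideal.map_map, Ideal.map_span, Set.image_singleton, map_pow] at h3
    have h4 : ((e.symm : O₀ →+* O).comp (e : O →+* O₀)) = RingHom.id O := by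
      ext a; simp
    rw [h4, Ideal.map_id] at h3
    exact h3
  have hx₀ : IsLexMaxWeightedCentreGerm O₀ (stalkIdeal X₀ (g.base η')) (fun i => e (x i)) w ℓ := by
    rw [hX₀, ← hFe]
    exact LexMaxCentre.map_ringEquiv hx e
  -- the stalk `B` of `Y′` at `η′`: a localization of `A[ℤʲ]` at `P · A[ℤʲ]`, of dimension `2`
  set B := ((Spec (.of R')).presheaf.stalk η' : Type) with hBdef
  letI algB' : Algebra R' B := (StructureSheaf.toStalk R' η').hom.toAlgebra
  have hlocB' : IsLocalization.AtPrime B η'.asIdeal := StructureSheaf.IsLocalization.to_stalk R' η'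
  letI algB : Algebra A[Fin j → ℤ] B := ((algebraMap R' B).comp (algebraMap A[Fin j → ℤ] R')).toAlgebra
  haveI : IsScalarTower A[Fin j → ℤ] R' B := ⟨fun a r b => by
    simp only [Algebra.smul_def, RingHom.algebraMap_toAlgebra, RingHom.comp_apply, map_mul, mul_assoc]⟩
  haveI hlocB : IsLocalization.AtPrime B (P.map (singleZeroRingHom : A →+* A[Fin j → ℤ])) := by
    have h := IsLocalization.isLocalization_isLocalization_atPrime_isLocalization
      (Algebra.algebraMapSubmonoid A[Fin j → ℤ] (k[Fin j → ℤ])⁰) (T := B) η'.asIdeal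
    have hM : (P.map (singleZeroRingHom : A →+* A[Fin j → ℤ])).primeCompl =
        (η'.asIdeal.comap (algebraMap A[Fin j → ℤ] R')).primeCompl := by
      ext a; simp only [Ideal.mem_primeCompl_iff, hη'comap]
    change IsLocalization (P.map (singleZeroRingHom : A →+* A[Fin j → ℤ])).primeCompl B
    rw [hM]
    exact h
  have hdimB : ringKrullDim B = ((2 : ℕ) : WithBot ℕ∞) := by
    rw [ringKrullDim_eq_of_isLocalization_atPrime_map P O (P.map (singleZeroRingHom : A →+* A[Fin j → ℤ])) rfl B]
    exact hdim
  -- Abramovich–Quek–Schober's separable base change at `k(ℤʲ)`, read at `η′`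
  have H := hAQS₂ k (Spec (.of A)) f₀ X₀ (FractionRing k[Fin j → ℤ]) (Spec (.of R'))
    (Spec.map (CommRingCat.ofHom (algebraMap (FractionRing k[Fin j → ℤ]) R'))) g hsq η' hdimB
    hreg₀ hdim₀ hprinc₀ hne₀ hnot₀ (fun i => e (x i)) w ℓ hx₀
  -- the two local maps `ε_P, ρ_P : O → B`
  let εP : O →+* B := (g.stalkMap η').hom.comp (e : O →+* O₀)
  have hstalk : (g.stalkMap η').hom.comp (algebraMap A O₀) =
      (algebraMap R' B).comp (algebraMap A R') := by
    have h := congrArg CommRingCat.Hom.hom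
      (AlgebraicGeometry.stalkMap_toStalk (CommRingCat.ofHom (algebraMap A R')) η')
    exact h
  have hε : εP.comp (algebraMap A O) =
      (algebraMap A[Fin j → ℤ] B).comp (singleZeroRingHom : A →+* A[Fin j → ℤ]) := by
    rw [RingHom.comp_assoc, he, hstalk, hAR', ← RingHom.comp_assoc]
    rfl
  have hunit : ∀ s : P.primeCompl, IsUnit (((algebraMap A[Fin j → ℤ] B).comp ρ) s) := by
    intro s
    exact IsLocalization.map_units B
      (⟨ρ s, coaction_not_mem_map_of_not_mem 𝒜 ρ hρ P s.2⟩ : (P.map (singleZeroRingHom : A →+* A[Fin j → ℤ])).primeCompl)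
  let ρP : O →+* B := IsLocalization.lift (M := P.primeCompl) (S := O) hunit
  have hρP : ρP.comp (algebraMap A O) = (algebraMap A[Fin j → ℤ] B).comp ρ :=
    IsLocalization.lift_comp hunit
  -- `x` spans `P · O`
  have hxspan : Ideal.span (Set.range x) = P.map (algebraMap A O) := by
    rw [hx.1, ← IsLocalization.AtPrime.under_maximalIdeal O P, Ideal.under_def,
      IsLocalization.map_under P.primeCompl (S := O)]
  -- the lex-maximal centre at the generic torus point, in the kernel's shape
  have hB : IsLexMaxWeightedCentreGerm B ((F.map (algebraMap A O)).map εP) (fun i => εP (x i)) w ℓ := by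
    have hI : (F.map (algebraMap A O)).map εP = stalkIdeal (X₀.comap g) η' := by
      rw [stalkIdeal_comap_eq_map_stalkMap, hX₀, ← hFe]
      simp only [Ideal.map_map]
      rfl
    rw [hI]
    exact H
  exact isHomogeneous_comap_weightedMonomialIdeal 𝒜 ρ hρ P O (P.map (singleZeroRingHom : A →+* A[Fin j → ℤ]))
    rfl B εP ρP hε hρP hP F hF x w ℓ hxspan hB n

end Main


/-! ## §8 The closer in the e-ladder's vocabulary: the contracted centre is homogeneous on every graded affine
chart of the ambient -/

section Scheme

/-- **(L3) «(hom) for all chart gradings of the orbit centre».**  Let `Y → Spec k` be locally of finite type,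
`X` an ideal sheaf on `Y`, `η ∈ Y` a point with regular 2-dimensional local ring at which `X_η` is principal,
non-zero and not of the form `(y^ν)` (`C_red` singular at `η`), and `(x; w; ℓ)` the lex-maximal admissible weighted
centre germ of `X_η` (Abramovich–Quek–Schober, `AbramovichQuekSchober2025_heightTwoCentre`).  Let `W ∋ η` be an
affine open and `𝒜` ANY `ℤʲ`-grading of `Γ(Y, W)` for which `X(W)` and the prime of `η` (the orbit closure
`closure {η} ∩ W`; in the e-ladder: `isHomogeneous_of_mem_minimalPrimes_vanishingIdeal_singSet`) are homogeneous.
ASSUMING `AbramovichQuekSchober2025_separableBaseChange`, every contracted piece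
`germContractionIdeal η (x^α : w·α ≥ n) W` of the orbit centre (`ReesAlgebraData.ofGermFiltration`) is
HOMOGENEOUS — the clause `(hom)` of `IsAdmissibleCentre` for the centre of `stub_e1_centre`, chart by chart; no
hypothesis on the degree of the constants, no density, `k` finite allowed.
[cite: AbramovichQuekSchober2025, Thm 1.1 (1) via Thm 3.5 and §5 (i)] -/
theorem isHomogeneous_germContractionIdeal_weightedMonomialIdeal
    (hAQS₂ : AbramovichQuekSchober2025_separableBaseChange)
    {k : Type} [Field k] {Y : Scheme.{0}} (f : Y ⟶ Spec (.of k)) [LocallyOfFiniteType f]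
    (X : Y.IdealSheafData) (η : Y)
    (hreg : IsRegularLocalRing (Y.presheaf.stalk η))
    (hdim : ringKrullDim (Y.presheaf.stalk η) = ((2 : ℕ) : WithBot ℕ∞))
    (hprinc : (stalkIdeal X η).IsPrincipal) (hne : stalkIdeal X η ≠ ⊥)
    (hnot : ∀ y ∈ maximalIdeal (Y.presheaf.stalk η), y ∉ maximalIdeal (Y.presheaf.stalk η) ^ 2 →
      ∀ ν : ℕ, stalkIdeal X η ≠ Ideal.span {y ^ ν})
    (x : Fin 2 → Y.presheaf.stalk η) (w : Fin 2 → ℕ) (ℓ : ℕ)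
    (hx : IsLexMaxWeightedCentreGerm (Y.presheaf.stalk η) (stalkIdeal X η) x w ℓ)
    {j : ℕ} (W : Y.affineOpens) (hηW : η ∈ (W : Y.Opens))
    (𝒜 : (Fin j → ℤ) → AddSubgroup Γ(Y, W)) [GradedRing 𝒜]
    (hX : (X.ideal W).IsHomogeneous 𝒜)
    (hP : ((W.2.primeIdealOf ⟨η, hηW⟩).asIdeal).IsHomogeneous 𝒜) (n : ℕ) :
    (germContractionIdeal η (weightedMonomialIdeal x w n) W).IsHomogeneous 𝒜 := by
  -- `Γ(Y, W)` is a finitely generated `k`-algebra and `𝒪_{Y,η}` its localization at the prime of `η`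
  letI algk : Algebra k Γ(Y, W) :=
    ((f.appLE ⊤ (W : Y.Opens) le_top).hom.comp (Scheme.ΓSpecIso (.of k)).inv.hom).toAlgebra
  haveI : Algebra.FiniteType k Γ(Y, W) := by
    have h1 : (f.appLE ⊤ (W : Y.Opens) le_top).hom.FiniteType :=
      HasRingHomProperty.appLE @LocallyOfFiniteType f inferInstance ⟨⊤, isAffineOpen_top _⟩ W le_top
    have h2 : ((f.appLE ⊤ (W : Y.Opens) le_top).hom.comp (Scheme.ΓSpecIso (.of k)).inv.hom).FiniteType :=
      h1.comp (RingHom.FiniteType.of_surjective _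
        (Scheme.ΓSpecIso (.of k)).commRingCatIsoToRingEquiv.symm.surjective)
    exact h2
  letI := TopCat.Presheaf.algebra_section_stalk Y.presheaf (⟨η, hηW⟩ : (W : Y.Opens))
  haveI := W.2.isLocalization_stalk ⟨η, hηW⟩
  rw [germContractionIdeal_of_mem η _ hηW]
  have hst : stalkIdeal X η = (X.ideal W).map (algebraMap Γ(Y, W) (Y.presheaf.stalk η)) :=
    stalkIdeal_eq_map_germ X W hηW
  rw [hst] at hprinc hne hnot hx
  exact isHomogeneous_comap_weightedMonomialIdeal_of_separableBaseChange (k := k) hAQS₂ 𝒜 (X.ideal W) hX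
    (W.2.primeIdealOf ⟨η, hηW⟩).asIdeal hP (Y.presheaf.stalk η) hreg hdim hprinc hne hnot x w ℓ hx n

end Scheme

end Summit.ResolutionOfSingularities.ResolutionOfSingularities.Theorems.OrbitCentreHomogeneous

end
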